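import Literature.RepresentationTheory.FiniteGroups.SymmetricGroupFixedWords
import HarnessLib

/-!
# Peeling a cycle off the fixed-word enumerator (the Murnaghan–Nakayama step in exponent form)

Topic `Literature/RepresentationTheory/FiniteGroups`. Elementary companions to Frobenius's
character formula (`SymmetricGroupFrobeniusFormula.lean`) that turn it into character VALUES
(Fulton–Harris, *Representation Theory*, §4.1 (4.10) and Ex. 4.45; Macdonald, *Symmetric
Functions*, Ch. I §3 Ex. 11 and §7 Ex. 5 — the Murnaghan–Nakayama rule is
`p_m · a_ν = ∑_i a_{ν + m e_i}` read through `χ^λ = [x^{λ+ρ}] a_ρ ∏ p`). All PROVED: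

* `fixedWordPoly_cycle_mul` — **peeling**: for a cycle `c` disjoint from `τ`,
  `F_{cτ}(x) = p_{|supp c|}(x) · F_{τ|B}(x)`, `B = (supp c)ᶜ` (a word is fixed by `cτ` iff it is
  constant on the cycle and its restriction to `B` is fixed by `τ`); with
  `cycleType_subtypePerm_of_disjoint`, `cycleType_permCongr` to track the cycle type of `τ|B`.
* `coeff_psum_mul` — `[x^α](p_m G) = ∑_{i : α_i ≥ m} [x^{α - m e_i}] G`.
* `rename_alternant_mul_fixedWordPoly`, `coeff_mapDomain_of_rename_eq` — `a_ρ(X) F_σ(X)` is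
  antisymmetric under permutations `g` of the variables (`alternant_perm_comp`: a ROW permutation
  of `det(x_i^{μ_j})`; the tree's `alternant_comp_perm` permutes the exponents), hence its
  coefficients at `g·α` and `α` differ by `sign(g)` — the sign of the rim hook in
  Murnaghan–Nakayama.

First consumer: `Literature/Computability/Complexity/OccurrenceObstructionsIPSquareValues.lean`
(the two character values of the square shape behind Bessenrodt–Behns' `g(a×a, a×a, a×a) > 0`).

## References

* W. Fulton, J. Harris, *Representation Theory. A First Course*, GTM 129 (1991), §4.1 (4.10),
  Exercise 4.45 (Murnaghan–Nakayama from Frobenius's formula). [FultonHarrisGTM129]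
* I. G. Macdonald, *Symmetric Functions and Hall Polynomials*, 2nd ed. (1995), Ch. I §3 Ex. 11,
  §7 Ex. 5. [Macdonald1995]

## Mathlib and tree

Mathlib: `Equiv.Perm.IsCycle.exists_pow_eq`, `Equiv.Perm.Disjoint`, `Equiv.Perm.subtypePerm`,
`ofSubtype_subtypePerm`, `cycleType_ofSubtype`, `cycleType_extendDomain`, `Matrix.det_permute`,
`MvPolynomial.coeff_rename_mapDomain`, `coeff_monomial_mul'`, `Finset.prod_mul_prod_compl`,
`Finset.sum_nbij'`. Tree: `fixedWordPoly`, `rename_fixedWordPoly`, `alternant_X_eq_sum_monomial`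
(`SymmetricGroupFixedWords.lean`); `alternant`, `map_alternant` (`SchurPolynomials.lean`).
-/

noncomputable section

open scoped BigOperators
open MvPolynomial Finset

namespace Literature.RepresentationTheory.FiniteGroups

open Literature.RingTheory.SymmetricFunctions.SymmPoly (alternant alternant_eq_sum rho rho_apply
  map_alternant)

/-! ### Antisymmetry of `a_ρ(X) · F_σ(X)` -/

section Antisymmetry

variable {ι : Type*} [Fintype ι] [DecidableEq ι] {N : ℕ}

/-- Permuting the VARIABLES multiplies an alternant by the sign: `a_μ(x ∘ g) = sign(g) a_μ(x)`
(row permutation of `det(x_i^{μ_j})`; the tree's `alternant_comp_perm` permutes the exponents).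
[folklore] -/
theorem alternant_perm_comp {R : Type*} [CommRing R] {n : ℕ} (x : Fin n → R) (μ : Fin n → ℕ)
    (g : Equiv.Perm (Fin n)) :
    alternant (x ∘ ⇑g) μ = ((Equiv.Perm.sign g : ℤ) : R) * alternant x μ := by
  have : (Matrix.of fun i j : Fin n => (x ∘ ⇑g) i ^ μ j) =
      (Matrix.of fun i j : Fin n => x i ^ μ j).submatrix g id := rfl
  rw [alternant, this, Matrix.det_permute]
  rfl

/-- `rename g (a_μ(X)) = sign(g) · a_μ(X)`. [folklore] -/
theorem rename_alternant_X (μ : Fin N → ℕ) (g : Equiv.Perm (Fin N)) :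
    rename g (alternant (fun i => (X i : MvPolynomial (Fin N) ℤ)) μ) =
      ((Equiv.Perm.sign g : ℤ) : MvPolynomial (Fin N) ℤ) *
        alternant (fun i => (X i : MvPolynomial (Fin N) ℤ)) μ := by
  rw [show rename g (alternant (fun i => (X i : MvPolynomial (Fin N) ℤ)) μ) =
      alternant ((fun i => (X i : MvPolynomial (Fin N) ℤ)) ∘ ⇑g) μ from ?_, alternant_perm_comp]
  rw [← AlgHom.coe_toRingHom, map_alternant]
  congr 1
  funext i
  simp

/-- **`a_μ(X) · F_σ(X)` is antisymmetric** under permutations of the variables. [folklore] -/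
theorem rename_alternant_mul_fixedWordPoly (μ : Fin N → ℕ) (σ : Equiv.Perm ι)
    (g : Equiv.Perm (Fin N)) :
    rename g (alternant (fun i => (X i : MvPolynomial (Fin N) ℤ)) μ * fixedWordPoly N σ) =
      ((Equiv.Perm.sign g : ℤ) : MvPolynomial (Fin N) ℤ) *
        (alternant (fun i => (X i : MvPolynomial (Fin N) ℤ)) μ * fixedWordPoly N σ) := by
  rw [map_mul, rename_alternant_X, rename_fixedWordPoly, mul_assoc]

/-- Coefficients of an antisymmetric polynomial at permuted exponents:
`[x^{g·α}] f = sign(g) [x^α] f` when `rename g f = sign(g) f`. [folklore] -/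
theorem coeff_mapDomain_of_rename_eq {f : MvPolynomial (Fin N) ℤ} {g : Equiv.Perm (Fin N)}
    (hf : rename g f = ((Equiv.Perm.sign g : ℤ) : MvPolynomial (Fin N) ℤ) * f) (α : Fin N →₀ ℕ) :
    coeff (Finsupp.mapDomain g α) f = (Equiv.Perm.sign g : ℤ) * coeff α f := by
  have h := coeff_rename_mapDomain g g.injective f α
  rw [hf] at h
  have hC : ((Equiv.Perm.sign g : ℤ) : MvPolynomial (Fin N) ℤ) = C (Equiv.Perm.sign g : ℤ) := by
    simp
  rw [hC, coeff_C_mul] at h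
  rw [← h, ← mul_assoc, ← Units.val_mul, Int.units_mul_self, Units.val_one, one_mul]

end Antisymmetry

/-! ### Coefficients of `p_m · G` -/

section PowerSum

variable {N : ℕ}

/-- **Multiplication by a power sum**: `[x^α](p_m · G) = ∑_{i : α_i ≥ m} [x^{α - m e_i}] G`
(`p_m = ∑_i x_i^m`). With `G = a_{ν}` an alternant this is the exponent form of the
Murnaghan–Nakayama step `p_m a_ν = ∑_i a_{ν + m e_i}` (Macdonald I §3 Ex. 11, Fulton–Harris
Ex. 4.45). [cite: Macdonald1995, Ch. I §3 Example 11] -/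
theorem coeff_psum_mul (m : ℕ) (G : MvPolynomial (Fin N) ℤ) (α : Fin N →₀ ℕ) :
    coeff α ((∑ i : Fin N, (X i : MvPolynomial (Fin N) ℤ) ^ m) * G) =
      ∑ i ∈ univ.filter (fun i : Fin N => m ≤ α i), coeff (α - Finsupp.single i m) G := by
  rw [Finset.sum_mul, coeff_sum, Finset.sum_filter]
  refine Finset.sum_congr rfl fun i _ => ?_
  rw [X_pow_eq_monomial, coeff_monomial_mul']
  by_cases h : m ≤ α i
  · rw [if_pos (Finsupp.single_le_iff.2 h), if_pos h, one_mul]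
  · rw [if_neg (fun h' => h (Finsupp.single_le_iff.1 h')), if_neg h]

end PowerSum

/-! ### Peeling a cycle: `F_{c τ} = p_{|c|} · F_{τ|B}` -/

section Peel

variable {ι : Type*} [Fintype ι] [DecidableEq ι] {N : ℕ}

/-- For disjoint `c, τ`, the complement of the support of `c` is `τ`-stable. [folklore] -/
theorem mem_compl_support_iff_of_disjoint {c τ : Equiv.Perm ι} (hd : c.Disjoint τ) (x : ι) :
    τ x ∈ c.supportᶜ ↔ x ∈ c.supportᶜ := by
  rw [Finset.mem_compl, Finset.mem_compl, Equiv.Perm.mem_support, Equiv.Perm.mem_support, not_not,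
    not_not]
  constructor
  · intro hx
    by_contra h
    rcases hd x with h' | h'
    · exact h h'
    · rw [h'] at hx
      exact h hx
  · intro hx
    -- `c x = x`; if `c (τ x) ≠ τ x` then `τ (τ x) = τ x`, so `τ x = x`, contradiction
    by_contra h
    rcases hd (τ x) with h' | h'
    · exact h h'
    · have := τ.injective h'
      rw [this] at h
      exact h hx

/-- A word fixed along a cycle takes the same value along the orbit. [folklore] -/
theorem apply_pow_apply_eq {c : Equiv.Perm ι} {w : ι → Fin N}
    (hw : ∀ x ∈ c.support, w (c x) = w x) {x : ι} (hx : x ∈ c.support) (i : ℕ) :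
    w ((c ^ i) x) = w x := by
  induction i with
  | zero => simp
  | succ i ih =>
    rw [pow_succ', Equiv.Perm.mul_apply, hw _ (Equiv.Perm.pow_apply_mem_support.2 hx), ih]

/-- A word fixed along a cycle is constant on its support. [folklore] -/
theorem apply_eq_of_isCycle {c : Equiv.Perm ι} (hc : c.IsCycle) {w : ι → Fin N}
    (hw : ∀ x ∈ c.support, w (c x) = w x) {x y : ι} (hx : x ∈ c.support) (hy : y ∈ c.support) :
    w x = w y := by
  obtain ⟨i, rfl⟩ := hc.exists_pow_eq (Equiv.Perm.mem_support.1 hx) (Equiv.Perm.mem_support.1 hy)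
  exact (apply_pow_apply_eq hw hx i).symm

/-- **Peeling a cycle off the fixed-word enumerator**: if `c` is a cycle disjoint from `τ`, then
`F_{cτ}(x) = p_{|supp c|}(x) · F_{τ|B}(x)`, `B` the complement of the support of `c`
(a word is fixed by `cτ` iff it is constant on the cycle and its restriction to `B` is fixed by
`τ`). This is the factor `P_m` of `∏_j P_j^{i_j}` in Frobenius's formula / the induction step of the
Murnaghan–Nakayama rule (Fulton–Harris §4.1 (4.10), Ex. 4.45). [cite: FultonHarrisGTM129, §4.1 (4.10)] -/
theorem fixedWordPoly_cycle_mul {c τ : Equiv.Perm ι} (hd : c.Disjoint τ) (hc : c.IsCycle) :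
    fixedWordPoly N (c * τ) = (∑ i : Fin N, (X i : MvPolynomial (Fin N) ℤ) ^ c.support.card) *
      fixedWordPoly N (τ.subtypePerm (p := fun x => x ∈ c.supportᶜ)
        (fun x => mem_compl_support_iff_of_disjoint hd x)) := by
  classical
  set B := c.supportᶜ with hB
  set τB := τ.subtypePerm (p := fun x => x ∈ c.supportᶜ)
    (fun x => mem_compl_support_iff_of_disjoint hd x) with hτB
  have hc' := hc
  obtain ⟨x₀, hx₀, -⟩ := hc'
  have hx₀' : x₀ ∈ c.support := Equiv.Perm.mem_support.2 hx₀
  have hx₀B : x₀ ∉ B := by rw [hB, Finset.mem_compl, not_not]; exact hx₀'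
  have hnotB : ∀ x ∈ c.support, x ∉ B := fun x hx => by
    rw [hB, Finset.mem_compl, not_not]; exact hx
  -- how `c τ` acts
  have hon : ∀ x ∈ c.support, (c * τ) x = c x := by
    intro x hx
    rw [Equiv.Perm.mul_apply]
    rcases hd x with h | h
    · exact absurd h (Equiv.Perm.mem_support.1 hx)
    · rw [h]
  have hoff : ∀ x ∈ B, (c * τ) x = τ x := by
    intro x hx
    rw [Equiv.Perm.mul_apply]
    have hτx : τ x ∈ B := (mem_compl_support_iff_of_disjoint hd x).2 hx
    rw [hB, Finset.mem_compl, Equiv.Perm.mem_support, not_not] at hτx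
    exact hτx
  -- characterisation of the fixed words
  have hfix : ∀ w : ι → Fin N, w ∘ ⇑(c * τ) = w ↔
      (∀ x ∈ c.support, w x = w x₀) ∧ (fun b : B => w b) ∘ ⇑τB = fun b : B => w b := by
    intro w
    constructor
    · intro h
      have h' := congr_fun h
      refine ⟨fun x hx => ?_, ?_⟩
      · refine apply_eq_of_isCycle hc (fun y hy => ?_) hx hx₀'
        have := h' y
        rwa [Function.comp_apply, hon y hy] at this
      · funext b
        have := h' b
        simp only [Function.comp_apply] at this ⊢
        rw [hτB, Equiv.Perm.subtypePerm_apply, ← this, hoff _ b.2]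
    · rintro ⟨h1, h2⟩
      funext x
      simp only [Function.comp_apply]
      by_cases hx : x ∈ c.support
      · rw [hon x hx, h1 _ (Equiv.Perm.apply_mem_support.2 hx), h1 x hx]
      · have hxB : x ∈ B := by rwa [hB, Finset.mem_compl]
        have := congr_fun h2 ⟨x, hxB⟩
        simp only [Function.comp_apply, hτB, Equiv.Perm.subtypePerm_apply] at this
        rw [hoff x hxB]
        exact this
  -- the gluing map `(i, u) ↦ w` and the bijection with `w ↦ (w x₀, w|B)`
  set glue : Fin N × (B → Fin N) → (ι → Fin N) :=
    fun q x => if hx : x ∈ B then q.2 ⟨x, hx⟩ else q.1 with hglue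
  have glue_of_mem : ∀ (i : Fin N) (u : B → Fin N) (b : B), glue (i, u) b = u b := by
    intro i u b
    simp [hglue, b.2]
  have glue_of_not_mem : ∀ (i : Fin N) (u : B → Fin N) (x : ι), x ∉ B → glue (i, u) x = i := by
    intro i u x hx
    simp [hglue, hx]
  unfold fixedWordPoly
  rw [Finset.sum_mul_sum, ← Finset.sum_product']
  symm
  refine Finset.sum_nbij' glue (fun w => (w x₀, fun b => w b)) ?_ ?_ ?_ ?_ ?_
  · rintro ⟨i, u⟩ hq
    rw [Finset.mem_product, mem_filter] at hq
    obtain ⟨-, -, hu⟩ := hq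
    rw [mem_filter]
    refine ⟨mem_univ _, (hfix _).2 ⟨fun x hx => ?_, ?_⟩⟩
    · rw [glue_of_not_mem i u x (hnotB x hx), glue_of_not_mem i u x₀ hx₀B]
    · have hg : (fun b : B => glue (i, u) b) = u := funext (glue_of_mem i u)
      rw [hg]
      exact hu
  · intro w hw
    rw [mem_filter] at hw
    obtain ⟨-, h2⟩ := (hfix w).1 hw.2
    rw [Finset.mem_product, mem_filter]
    exact ⟨mem_univ _, mem_univ _, h2⟩
  · rintro ⟨i, u⟩ -
    refine Prod.ext (glue_of_not_mem i u x₀ hx₀B) (funext fun b => glue_of_mem i u b)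
  · intro w hw
    rw [mem_filter] at hw
    obtain ⟨h1, -⟩ := (hfix w).1 hw.2
    funext x
    by_cases hx : x ∈ B
    · exact glue_of_mem (w x₀) (fun b => w b) ⟨x, hx⟩
    · rw [glue_of_not_mem _ _ x hx]
      rw [hB, Finset.mem_compl, not_not] at hx
      exact (h1 x hx).symm
  · rintro ⟨i, u⟩ -
    -- the monomial splits over `supp c` and `B`
    rw [← Finset.prod_mul_prod_compl c.support (fun x => (X (glue (i, u) x) : MvPolynomial (Fin N) ℤ))]
    congr 1
    · rw [← Finset.prod_const]
      exact Finset.prod_congr rfl fun x hx => by rw [glue_of_not_mem i u x (hnotB x hx)]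
    · rw [← Finset.prod_coe_sort c.supportᶜ]
      exact Fintype.prod_congr _ _ fun b => by rw [glue_of_mem i u b]

end Peel

/-! ### Cycle types under restriction and transport -/

section CycleType

variable {ι κ : Type*} [Fintype ι] [DecidableEq ι] [Fintype κ] [DecidableEq κ]

/-- Transport along an equivalence preserves the cycle type. [folklore] -/
theorem cycleType_permCongr (e : ι ≃ κ) (g : Equiv.Perm ι) :
    (e.permCongr g).cycleType = g.cycleType := by
  classical
  have h := Equiv.Perm.cycleType_extendDomain (p := fun _ : κ => True)
    (e.trans (Equiv.subtypeUnivEquiv (fun _ => trivial)).symm) (g := g)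
  rw [← h]
  congr 1

/-- The restriction of `τ` to the `τ`-stable complement of the support of a disjoint `c` has the
cycle type of `τ`. [folklore] -/
theorem cycleType_subtypePerm_of_disjoint {c τ : Equiv.Perm ι} (hd : c.Disjoint τ) :
    (τ.subtypePerm (p := fun x => x ∈ c.supportᶜ)
      (fun x => mem_compl_support_iff_of_disjoint hd x)).cycleType = τ.cycleType := by
  classical
  conv_rhs => rw [← Equiv.Perm.ofSubtype_subtypePerm
    (f := τ) (p := fun x => x ∈ c.supportᶜ) (fun x => mem_compl_support_iff_of_disjoint hd x)
    (fun x hx => by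
      rw [Finset.mem_compl, Equiv.Perm.mem_support, not_not]
      rcases hd x with h | h
      · exact h
      · exact absurd h hx)]
  rw [Equiv.Perm.cycleType_ofSubtype]

end CycleType

end Literature.RepresentationTheory.FiniteGroups

end
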